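import Literature.MathematicalPhysics.QuantumLattice.HubbardKuboKishiGaussianDomination
import Literature.MathematicalPhysics.QuantumLattice.KroneckerTraceSchwarzProjected
import Literature.MathematicalPhysics.QuantumLattice.ProjectedBCSState
import Literature.MathematicalPhysics.QuantumLattice.HyperoctahedralFockAction
import Literature.LinearAlgebra.Matrix.PosSemidefTrace
import HarnessLib

/-!
# Kubo–Kishi's Gaussian domination in the canonical `(N↑, N↓)` sectors

Kubo–Kishi [KuboKishi1990] prove Gaussian domination for the attractive Hubbard model
(`U < 0`, spin-independent chemical potential) in the GRAND-CANONICAL ensemble: Trotter's formula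
and the identity `e^{-A²} = (4π)^{-1/2}∫e^{ikA - k²/4}dk` present `e^{-β(H - μN)}` in Lieb's
spin-split picture [LiebPRL1989, eq. (4)] as `exp(A⊗1 + 1⊗A + Σₓ Mₓ⊗Mₓ)` with REAL one-species
matrices (`A = -β(T - μN)`, `Mₓ = (β|U|)^{1/2} nₓ`), and Schwarz's inequality between the up- and
down-spin traces (their eqs. (8)–(9); Dyson–Lieb–Simon [DLS1978] Lemma 4.1) gives
`Ξ({h}) ≤ Ξ` (their (7)). Every Trotter factor conserves `N↑` and `N↓` separately, so the same
argument runs inside each pair of particle-number sectors: with `P_k` the (real, diagonal)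
projection of the one-species Fock space onto `k` particles, DLS's Lemma 4.1 on the invariant
subspace `Ran P_k ⊗ Ran P_l` (`trace_kronecker_mul_exp_kroneckerSum_le`) gives the
**sector Gaussian domination**

  `Re Tr[P_{k,l} e^{-β(H - μN - M_a + Σₓaₓ²/(2|U|))}]
      ≤ (Re Tr[P_{k,k} e^{-β(H - μN)}])^{1/2} (Re Tr[P_{l,l} e^{-β(H - μN)}])^{1/2}`,

`P_{k,l}` = projection onto `N↑ = k`, `N↓ = l` (`spinSectorProj k l`, the matrix of Lieb's
`sectorProj`), `M_a = Σₓ aₓ(n_{x↑} - n_{x↓})` (`hubbard_attractive_sectorGaussianDomination`).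
Two readings: (i) `k = l`, the CANONICAL Kubo–Kishi inequality `Z_{k,k}(a) ≤ Z_{k,k}(0)` in every
balanced sector (hence, downstream, their susceptibility bound `χ ≤ 1/|U|` canonically);
(ii) `a = 0`, the finite-temperature form of Lieb's spin-reflection positivity:
`Z_{k,l}² ≤ Z_{k,k} Z_{l,l}` — the balanced sectors dominate the canonical partition functions of
the attractive Hubbard model on ANY finite graph (`hubbard_attractive_sectorPartitionFn_sq_le`).

Supporting transport (all bookkeeping): `spinSplitHom (spinSectorProj k l) = P_k ⊗ P_l`
(`spinSplitHom_spinSectorProj`), the number projections are real idempotents commuting with the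
spinless hopping matrix and the site occupations.

References: K. Kubo, T. Kishi, Phys. Rev. B 41 (1990) 4866, Theorem 1 and eqs. (7)–(9);
F. J. Dyson, E. H. Lieb, B. Simon, J. Stat. Phys. 18 (1978) 335, Lemma 4.1;
E. H. Lieb, Phys. Rev. Lett. 62 (1989) 1201, eq. (4) and proof of Theorem 1.
-/

noncomputable section

namespace Literature.MathematicalPhysics.QuantumLattice

open Matrix Finset HubbardWave0 JWSplit NormedSpace
open scoped Kronecker ComplexOrder

/-! ### One species: the particle-number projections -/

section OneSpecies

variable {ι : Type*} [LinearOrder ι]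

/-- `P_N` is a real matrix: `P_Nᵀ = P_N`. [folklore] -/
private theorem transpose_numberProj (N : ℕ) :
    (numberProj N : Matrix (Finset ι) (Finset ι) ℂ)ᵀ = numberProj N :=
  diagonal_transpose _

/-- `P_N` is Hermitian: `P_Nᴴ = P_N`. [folklore] -/
private theorem conjTranspose_numberProj (N : ℕ) :
    (numberProj N : Matrix (Finset ι) (Finset ι) ℂ)ᴴ = numberProj N := by
  rw [numberProj, diagonal_conjTranspose]
  congr 1
  funext s
  by_cases h : s.card = N <;> simp [h]

/-- `P_N` is real in the `Xᵀ = Xᴴ` sense of `KroneckerTraceSchwarz`. [folklore] -/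
private theorem transpose_numberProj_eq_conjTranspose (N : ℕ) :
    (numberProj N : Matrix (Finset ι) (Finset ι) ℂ)ᵀ = (numberProj N)ᴴ := by
  rw [transpose_numberProj, conjTranspose_numberProj]

variable [Fintype ι]

/-- `P_N² = P_N`. [folklore] -/
private theorem numberProj_mul_numberProj (N : ℕ) :
    (numberProj N : Matrix (Finset ι) (Finset ι) ℂ) * numberProj N = numberProj N := by
  rw [numberProj, diagonal_mul_diagonal]
  congr 1
  funext s
  by_cases h : s.card = N <;> simp [h]

/-- A matrix whose nonzero entries join configurations with the same particle number commutes
with every function of the particle number. [folklore] -/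
private theorem commute_diagonal_card_of_apply_ne_zero {X : Matrix (Finset ι) (Finset ι) ℂ}
    (hX : ∀ s t, X s t ≠ 0 → s.card = t.card) (f : ℕ → ℂ) :
    Commute X (diagonal fun s : Finset ι => f s.card) := by
  change X * diagonal (fun s : Finset ι => f s.card) = diagonal (fun s : Finset ι => f s.card) * X
  ext s t
  rw [mul_diagonal, diagonal_mul]
  by_cases h : X s t = 0
  · rw [h, zero_mul, mul_zero]
  · rw [hX s t h, mul_comm]

/-- A hopping term `c†_i c_j` preserves the particle number (support on equal cardinalities).
[folklore] -/
private theorem card_eq_of_creation_mul_annihilation_apply_ne_zero {i j : ι} {s t : Finset ι}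
    (h : (creation i * annihilation j) s t ≠ 0) : s.card = t.card := by
  obtain ⟨hi, hj, rfl⟩ := LiebTwo.creation_mul_annihilation_apply_ne_zero h
  rw [card_insert_of_notMem hj, card_erase_of_mem hi]
  have := Finset.card_pos.2 ⟨i, hi⟩
  omega

variable (G : SimpleGraph ι) [DecidableRel G.Adj]

/-- The spinless hopping matrix preserves the particle number (support on equal cardinalities).
[cite: LiebPRL1989, Remark (2)] -/
theorem card_eq_of_hoppingMatrix_apply_ne_zero (t : ℝ) {s u : Finset ι}
    (h : hoppingMatrix G t s u ≠ 0) : s.card = u.card := by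
  rw [hoppingMatrix_apply] at h
  have h' : ∑ x : ι, ∑ y : ι,
      (if G.Adj x y then (creation x * annihilation y) s u else 0) ≠ 0 := by
    intro h0
    exact h (by rw [h0, mul_zero])
  obtain ⟨x, -, hx⟩ := Finset.exists_ne_zero_of_sum_ne_zero h'
  obtain ⟨y, -, hy⟩ := Finset.exists_ne_zero_of_sum_ne_zero hx
  by_cases hxy : G.Adj x y
  · rw [if_pos hxy] at hy
    exact card_eq_of_creation_mul_annihilation_apply_ne_zero hy
  · exact absurd (if_neg hxy) hy

/-- `[P_N, T] = 0`: the number projections commute with the spinless hopping matrix.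
[cite: LiebPRL1989, Remark (2)] -/
theorem commute_numberProj_hoppingMatrix (N : ℕ) (t : ℝ) :
    Commute (numberProj N : Matrix (Finset ι) (Finset ι) ℂ) (hoppingMatrix G t) :=
  (commute_diagonal_card_of_apply_ne_zero
    (fun _ _ h => card_eq_of_hoppingMatrix_apply_ne_zero G t h)
    (fun n => if n = N then (1 : ℂ) else 0)).symm

variable {G}

/-- `[P_N, n_x] = 0` (both diagonal). [folklore] -/
private theorem commute_numberProj_numberAt (N : ℕ) (x : ι) :
    Commute (numberProj N : Matrix (Finset ι) (Finset ι) ℂ) (numberAt x) := by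
  rw [numberAt_eq_diagonal, numberProj]
  change diagonal _ * diagonal _ = diagonal _ * diagonal _
  rw [diagonal_mul_diagonal, diagonal_mul_diagonal]
  congr 1
  funext s
  rw [mul_comm]

/-- `[P_N, N] = 0`. [folklore] -/
private theorem commute_numberProj_totalNumberOp (N : ℕ) :
    Commute (numberProj N : Matrix (Finset ι) (Finset ι) ℂ) totalNumberOp :=
  Commute.sum_right _ _ _ fun x _ => commute_numberProj_numberAt N x

end OneSpecies

/-! ### Transport of diagonal matrices under relabelling and splitting -/

section Transport

/-- Splitting a diagonal matrix: `diag(d) ↦ diag(d ∘ glue)`. [folklore] -/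
private theorem splitAlgEquiv_diagonal {ι₁ ι₂ : Type*} [LinearOrder ι₁] [LinearOrder ι₂] [Fintype ι₁]
    [Fintype ι₂] (d : Finset (ι₁ ⊕ₗ ι₂) → ℂ) :
    splitAlgEquiv (diagonal d) =
      diagonal fun p : Finset ι₁ × Finset ι₂ => d (splitEquiv.symm p) := by
  rw [splitAlgEquiv_apply, reindex_apply, submatrix_diagonal_equiv]
  rfl

variable {Λ : Type*} [LinearOrder Λ] [Fintype Λ]

/-- The spin factorisation of a diagonal Fock-space matrix is diagonal:
`Φ(diag d)_{(α,β)} = d(α↑ ∪ β↓)`. [folklore] -/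
private theorem spinSplitHom_diagonal (d : Finset (Orb Λ) → ℂ) :
    spinSplitHom (diagonal d) = diagonal fun p : Finset Λ × Finset Λ =>
      d ((spinSplit (Λ := Λ)).finsetCongr.symm (splitEquiv.symm p)) := by
  rw [spinSplitHom_apply, relabel_diagonal, splitAlgEquiv_apply, reindex_apply, submatrix_diagonal_equiv]
  rfl

/-- The up part of the glued configuration `α↑ ∪ β↓` is `α`. [folklore] -/
private theorem upPart_spinSplit_glue (α β : Finset Λ) :
    upPart ((spinSplit (Λ := Λ)).finsetCongr.symm (splitEquiv.symm (α, β))) = α := by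
  ext x
  simp only [upPart, mem_filter, mem_univ, true_and, Equiv.finsetCongr_symm,
    Equiv.finsetCongr_apply, mem_map_equiv, Equiv.symm_symm, spinSplit_orb_zero,
    toLex_inl_mem_iff]

/-- The down part of the glued configuration `α↑ ∪ β↓` is `β`. [folklore] -/
private theorem downPart_spinSplit_glue (α β : Finset Λ) :
    downPart ((spinSplit (Λ := Λ)).finsetCongr.symm (splitEquiv.symm (α, β))) = β := by
  ext x
  simp only [downPart, mem_filter, mem_univ, true_and, Equiv.finsetCongr_symm,
    Equiv.finsetCongr_apply, mem_map_equiv, Equiv.symm_symm, spinSplit_orb_one,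
    toLex_inr_mem_iff]

end Transport

/-! ### The spin-sector projections `P_{k,l}` -/

section Sectors

variable {Λ : Type*} [LinearOrder Λ] [Fintype Λ]

/-- **The projection onto the sector `N↑ = k`, `N↓ = l`** of the Hubbard Fock space, as a matrix
(diagonal indicator in the occupation basis; its action on vectors is Lieb's `sectorProj k l`).
[cite: LiebPRL1989, proof of Theorem 1] -/
def spinSectorProj (k l : ℕ) : Matrix (Finset (Orb Λ)) (Finset (Orb Λ)) ℂ :=
  diagonal fun s => if (upPart s).card = k ∧ (downPart s).card = l then 1 else 0

/-- `P_{k,l}` acts on wave functions as the restriction to the sector (`sectorProj`). [cite: LiebPRL1989, proof of Theorem 1] -/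
theorem spinSectorProj_mulVec (k l : ℕ) (ψ : Fock (Orb Λ)) :
    spinSectorProj k l *ᵥ ψ = sectorProj k l ψ := by
  funext s
  rw [spinSectorProj, mulVec_diagonal, sectorProj_apply]
  by_cases h : (upPart s).card = k ∧ (downPart s).card = l <;> simp [h]

/-- `P_{k,l}² = P_{k,l}` (orthogonal projection onto Lieb's sector). [cite: LiebPRL1989, proof of Theorem 1] -/
theorem spinSectorProj_mul_self (k l : ℕ) :
    (spinSectorProj k l : Matrix (Finset (Orb Λ)) _ ℂ) * spinSectorProj k l = spinSectorProj k l := by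
  rw [spinSectorProj, diagonal_mul_diagonal]
  congr 1
  funext s
  by_cases h : (upPart s).card = k ∧ (downPart s).card = l <;> simp [h]

/-- `P_{k,l}ᴴ = P_{k,l}` (orthogonal projection onto Lieb's sector). [cite: LiebPRL1989, proof of Theorem 1] -/
theorem spinSectorProj_conjTranspose (k l : ℕ) :
    (spinSectorProj k l : Matrix (Finset (Orb Λ)) _ ℂ)ᴴ = spinSectorProj k l := by
  rw [spinSectorProj, diagonal_conjTranspose]
  congr 1
  funext s
  by_cases h : (upPart s).card = k ∧ (downPart s).card = l <;> simp [h]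

/-- `P_{k,l} = P_{k,l}ᴴ P_{k,l}` is positive semidefinite (orthogonal projection onto Lieb's sector). [cite: LiebPRL1989, proof of Theorem 1] -/
theorem posSemidef_spinSectorProj (k l : ℕ) :
    (spinSectorProj k l : Matrix (Finset (Orb Λ)) _ ℂ).PosSemidef := by
  have h : (spinSectorProj k l : Matrix (Finset (Orb Λ)) _ ℂ) =
      (spinSectorProj k l)ᴴ * spinSectorProj k l := by
    rw [spinSectorProj_conjTranspose, spinSectorProj_mul_self]
  rw [h]
  exact Matrix.posSemidef_conjTranspose_mul_self _

/-- **The sector projection factorises**: `Φ(P_{k,l}) = P_k ⊗ P_l` (Lieb's `ψ = Σ W_{αβ} ψ^α_↑ ⊗ ψ^β_↓`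
with `|α| = k`, `|β| = l`). [cite: LiebPRL1989, eq. (4) and proof of Theorem 1] -/
theorem spinSplitHom_spinSectorProj (k l : ℕ) :
    spinSplitHom (spinSectorProj k l : Matrix (Finset (Orb Λ)) _ ℂ) =
      (numberProj k : Matrix (Finset Λ) (Finset Λ) ℂ) ⊗ₖ (numberProj l : Matrix (Finset Λ) (Finset Λ) ℂ) := by
  rw [spinSectorProj, spinSplitHom_diagonal, numberProj, numberProj, diagonal_kronecker_diagonal]
  congr 1
  funext p
  obtain ⟨α, β⟩ := p
  simp only [upPart_spinSplit_glue, downPart_spinSplit_glue]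
  by_cases ha : α.card = k <;> by_cases hb : β.card = l <;> simp [ha, hb]

end Sectors

/-! ### Gaussian domination in the sectors -/

section Canonical

variable {Λ : Type*} [LinearOrder Λ] [Fintype Λ] (G : SimpleGraph Λ) [DecidableRel G.Adj]

/-- Scalar multiples of real matrices by self-conjugate scalars are real. [folklore] -/
private theorem transpose_eq_conjTranspose_smul_of_star_sector {μ : Type*} {X : Matrix μ μ ℂ}
    (hX : Xᵀ = Xᴴ) {z : ℂ} (hz : star z = z) : (z • X)ᵀ = (z • X)ᴴ := by
  rw [transpose_smul, conjTranspose_smul, hX, hz]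

/-- **Kubo–Kishi's Gaussian domination in the sectors `(N↑, N↓) = (k, l)` of the attractive Hubbard
model.** For every finite graph, real `t`, `U < 0`, real `μ`, `β > 0`, every real field `a` and all
`k, l`:
`Re Tr[P_{k,l} e^{-β(H(t,U) - μN - M_a + (Σₓaₓ²/(2|U|))·1)}]
   ≤ (Re Tr[P_{k,k} e^{-β(H(t,U) - μN)}])^{1/2} (Re Tr[P_{l,l} e^{-β(H(t,U) - μN)}])^{1/2}`,
`M_a = Σₓ aₓ(n_{x↑} - n_{x↓})`. Kubo–Kishi's proof of Theorem 1 (eqs. (7)–(9)) run on the invariant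
subspace `Ran P_k ⊗ Ran P_l` of Lieb's spin-split space: the Trotter/DLS presentation
`kk_exponent_field/zero/shifted` of the exponents, `Φ(P_{k,l}) = P_k ⊗ P_l`, and the sector form
of [DLS1978] Lemma 4.1 (`trace_kronecker_mul_exp_kroneckerSum_le`; the `P_N` are real idempotents
commuting with `T - μN` and every `nₓ`). With `P = 1` summed over sectors this is the tree's
`kuboKishi_spin_gaussianDomination_holds`.
[cite: KuboKishi1990, proof of Theorem 1, eqs. (7)–(9)] [cite: DLS1978, Lemma 4.1] [cite: LiebPRL1989, eq. (4)] -/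
theorem hubbard_attractive_sectorGaussianDomination (t U μ β : ℝ) (hU : U < 0) (hβ : 0 < β)
    (a : Λ → ℝ) (k l : ℕ) :
    ((spinSectorProj k l * gibbsWeight β (hamiltonianWith G t U μ - spinDensityField a +
        (((∑ x, a x ^ 2) / (2 * |U|) : ℝ) : ℂ) •
          (1 : Matrix (Finset (Orb Λ)) (Finset (Orb Λ)) ℂ))).trace).re ≤
      Real.sqrt ((spinSectorProj k k * gibbsWeight β (hamiltonianWith G t U μ)).trace).re *
        Real.sqrt ((spinSectorProj l l * gibbsWeight β (hamiltonianWith G t U μ)).trace).re := by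
  -- the scalars of the DLS presentation: `p² = -βU = β|U|`, `p q_x = β a_x`, `Σ q_x² = 2βc`
  have hβU : 0 < -(β * U) := by nlinarith
  set p : ℝ := Real.sqrt (-(β * U)) with hp_def
  have hp2 : p * p = -(β * U) := Real.mul_self_sqrt hβU.le
  have hp0 : p ≠ 0 := (Real.sqrt_pos.2 hβU).ne'
  have habs : |U| = -U := abs_of_neg hU
  set c : ℝ := (∑ x, a x ^ 2) / (2 * |U|) with hc_def
  set q : Λ → ℂ := fun x => ((β * a x / p : ℝ) : ℂ) with hq_def
  have hpC : (p : ℂ) * (p : ℂ) = -((β : ℂ) * (U : ℂ)) := by exact_mod_cast hp2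
  have hqC : ∀ x, (p : ℂ) * q x = (β : ℂ) * (a x : ℂ) := by
    intro x
    have h : p * (β * a x / p) = β * a x := by field_simp
    show (p : ℂ) * ((β * a x / p : ℝ) : ℂ) = (β : ℂ) * (a x : ℂ)
    exact_mod_cast h
  have hcC : ∑ x, q x * q x = 2 * (β : ℂ) * (c : ℂ) := by
    have hU0 : U ≠ 0 := hU.ne
    have hβ0 : β ≠ 0 := hβ.ne'
    have hU1 : |U| ≠ 0 := abs_ne_zero.2 hU0
    have h1 : ∀ x, (β * a x / p) * (β * a x / p) = β * a x ^ 2 / |U| := by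
      intro x
      rw [div_mul_div_comm, hp2, habs]
      field_simp
    have h : ∑ x, (β * a x / p) * (β * a x / p) = 2 * β * c := by
      rw [Finset.sum_congr rfl fun x _ => h1 x, hc_def, ← Finset.sum_div, ← Finset.mul_sum]
      field_simp
    show ∑ x, ((β * a x / p : ℝ) : ℂ) * ((β * a x / p : ℝ) : ℂ) = 2 * (β : ℂ) * (c : ℂ)
    exact_mod_cast h
  -- the matrices: `K = T - μN`, `n_x`, `P_k`, all real
  set K : Matrix (Finset Λ) (Finset Λ) ℂ := hoppingMatrix G t - (μ : ℂ) • totalNumberOp with hK_def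
  set n : Λ → Matrix (Finset Λ) (Finset Λ) ℂ := fun x => numberAt x with hn_def
  have hK : Kᵀ = Kᴴ := transpose_eq_conjTranspose_hoppingMatrix_sub G t μ
  have hn : ∀ x, (n x)ᵀ = (n x)ᴴ := fun x => transpose_eq_conjTranspose_numberAt x
  have hzβ : star (-(β : ℂ)) = -(β : ℂ) := by
    rw [star_neg, Complex.star_def, Complex.conj_ofReal]
  have hzr : ∀ r : ℝ, star (r : ℂ) = (r : ℂ) := fun r => by
    rw [Complex.star_def, Complex.conj_ofReal]
  have hF : (∑ x, (a x : ℂ) • n x)ᵀ = (∑ x, (a x : ℂ) • n x)ᴴ :=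
    transpose_eq_conjTranspose_sum _ fun x _ =>
      transpose_eq_conjTranspose_smul_of_star_sector (hn x) (hzr _)
  have hA : (-(β : ℂ) • K)ᵀ = (-(β : ℂ) • K)ᴴ :=
    transpose_eq_conjTranspose_smul_of_star_sector hK hzβ
  have hB : (-(β : ℂ) • K - (β : ℂ) • ∑ x, (a x : ℂ) • n x -
      ((β : ℂ) * (c : ℂ)) • (1 : Matrix (Finset Λ) (Finset Λ) ℂ))ᵀ =
      (-(β : ℂ) • K - (β : ℂ) • ∑ x, (a x : ℂ) • n x -
        ((β : ℂ) * (c : ℂ)) • (1 : Matrix (Finset Λ) (Finset Λ) ℂ))ᴴ := by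
    refine transpose_eq_conjTranspose_sub (transpose_eq_conjTranspose_sub hA
      (transpose_eq_conjTranspose_smul_of_star_sector hF (hzr _))) ?_
    refine transpose_eq_conjTranspose_smul_of_star_sector transpose_eq_conjTranspose_one ?_
    rw [star_mul', hzr, hzr]
  have hM : ∀ x, ((p : ℂ) • n x)ᵀ = ((p : ℂ) • n x)ᴴ := fun x =>
    transpose_eq_conjTranspose_smul_of_star_sector (hn x) (hzr _)
  have hN : ∀ x, ((p : ℂ) • n x + q x • (1 : Matrix (Finset Λ) (Finset Λ) ℂ))ᵀ =
      ((p : ℂ) • n x + q x • (1 : Matrix (Finset Λ) (Finset Λ) ℂ))ᴴ := fun x =>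
    transpose_eq_conjTranspose_add (hM x)
      (transpose_eq_conjTranspose_smul_of_star_sector transpose_eq_conjTranspose_one (by
        rw [hq_def]; exact hzr _))
  -- the projections: real idempotents commuting with everything in sight
  have hPK : ∀ j : ℕ, Commute (numberProj j : Matrix (Finset Λ) (Finset Λ) ℂ) K := fun j =>
    (commute_numberProj_hoppingMatrix G j t).sub_right ((commute_numberProj_totalNumberOp j).smul_right _)
  have hPn : ∀ (j : ℕ) (x : Λ), Commute (numberProj j : Matrix (Finset Λ) (Finset Λ) ℂ) (n x) :=
    fun j x => commute_numberProj_numberAt j x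
  have hPA : ∀ j : ℕ, Commute (numberProj j : Matrix (Finset Λ) (Finset Λ) ℂ) (-(β : ℂ) • K) :=
    fun j => (hPK j).smul_right _
  have hPM : ∀ (j : ℕ) (x : Λ), Commute (numberProj j : Matrix (Finset Λ) (Finset Λ) ℂ) ((p : ℂ) • n x) :=
    fun j x => (hPn j x).smul_right _
  have hPB : ∀ j : ℕ, Commute (numberProj j : Matrix (Finset Λ) (Finset Λ) ℂ)
      (-(β : ℂ) • K - (β : ℂ) • ∑ x, (a x : ℂ) • n x -
        ((β : ℂ) * (c : ℂ)) • (1 : Matrix (Finset Λ) (Finset Λ) ℂ)) := fun j =>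
    ((hPA j).sub_right ((Commute.sum_right _ _ _ fun x _ => (hPn j x).smul_right _).smul_right _)).sub_right
      ((Commute.one_right _).smul_right _)
  have hPN : ∀ (j : ℕ) (x : Λ), Commute (numberProj j : Matrix (Finset Λ) (Finset Λ) ℂ)
      ((p : ℂ) • n x + q x • (1 : Matrix (Finset Λ) (Finset Λ) ℂ)) := fun j x =>
    (hPM j x).add_right ((Commute.one_right _).smul_right _)
  -- Dyson–Lieb–Simon on `Ran P_k ⊗ Ran P_l`
  have hDLS := trace_kronecker_mul_exp_kroneckerSum_le (ι := Λ)
    (A := -(β : ℂ) • K)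
    (B := -(β : ℂ) • K - (β : ℂ) • ∑ x, (a x : ℂ) • n x -
      ((β : ℂ) * (c : ℂ)) • (1 : Matrix (Finset Λ) (Finset Λ) ℂ))
    (M := fun x => (p : ℂ) • n x)
    (Nn := fun x => (p : ℂ) • n x + q x • (1 : Matrix (Finset Λ) (Finset Λ) ℂ)) hA hB hM hN
    (transpose_numberProj_eq_conjTranspose k) (transpose_numberProj_eq_conjTranspose l)
    (numberProj_mul_numberProj k) (numberProj_mul_numberProj l) (hPA k) (hPM k) (hPB l) (hPN l)
  rw [kk_exponent_field K n (β : ℂ) (U : ℂ) (p : ℂ) (c : ℂ) (fun x => (a x : ℂ)) q hpC hqC,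
    kk_exponent_zero K n (β : ℂ) (U : ℂ) (p : ℂ) hpC,
    kk_exponent_shifted K n (β : ℂ) (U : ℂ) (p : ℂ) (c : ℂ) (fun x => (a x : ℂ)) q hpC hqC hcC]
    at hDLS
  -- the exponents are the images under `Φ` of `-β(H - μN - M_a + c)` and of `-β(H - μN)`
  have hΦ0 : spinSplitHom (-(β : ℂ) • hamiltonianWith G t U μ) =
      -(β : ℂ) • (K ⊗ₖ (1 : Matrix (Finset Λ) (Finset Λ) ℂ) + (1 : Matrix (Finset Λ) (Finset Λ) ℂ) ⊗ₖ K +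
        (U : ℂ) • ∑ x, n x ⊗ₖ n x) := by
    rw [map_smul, spinSplitHom_hamiltonianWith]
  have hΦa : spinSplitHom (-(β : ℂ) • (hamiltonianWith G t U μ - spinDensityField a +
      ((c : ℝ) : ℂ) • (1 : Matrix (Finset (Orb Λ)) (Finset (Orb Λ)) ℂ))) =
      -(β : ℂ) • (K ⊗ₖ (1 : Matrix (Finset Λ) (Finset Λ) ℂ) + (1 : Matrix (Finset Λ) (Finset Λ) ℂ) ⊗ₖ K +
        (U : ℂ) • ∑ x, n x ⊗ₖ n x -
        ∑ x, (a x : ℂ) • (n x ⊗ₖ (1 : Matrix (Finset Λ) (Finset Λ) ℂ) -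
          (1 : Matrix (Finset Λ) (Finset Λ) ℂ) ⊗ₖ n x) +
        (c : ℂ) • ((1 : Matrix (Finset Λ) (Finset Λ) ℂ) ⊗ₖ (1 : Matrix (Finset Λ) (Finset Λ) ℂ))) := by
    rw [map_smul, map_add, map_sub, spinSplitHom_hamiltonianWith, map_smul, spinSplitHom_one,
      spinDensityField, map_sum]
    congr 3
    refine Finset.sum_congr rfl fun x _ => ?_
    rw [map_smul, map_sub, spinSplitHom_numberOp_zero, spinSplitHom_numberOp_one]
  rw [← hΦ0, ← hΦa, ← spinSplitHom_exp, ← spinSplitHom_exp, ← spinSplitHom_spinSectorProj,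
    ← spinSplitHom_spinSectorProj, ← spinSplitHom_spinSectorProj, ← map_mul, ← map_mul, ← map_mul,
    trace_spinSplitHom, trace_spinSplitHom, trace_spinSplitHom] at hDLS
  simpa only [gibbsWeight] using hDLS

/-- **The balanced sectors dominate** (finite-temperature form of Lieb's spin-reflection
positivity, the field-free case of the previous theorem): for the attractive Hubbard model on any
finite graph, every `β > 0`, real `μ` and all `k, l`,
`(Re Tr[P_{k,l} e^{-β(H - μN)}])² ≤ Re Tr[P_{k,k} e^{-β(H - μN)}] · Re Tr[P_{l,l} e^{-β(H - μN)}]`,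
i.e. `Z_{k,l}² ≤ Z_{k,k} Z_{l,l}` for the canonical partition functions.
[cite: KuboKishi1990, proof of Theorem 1, eqs. (8)–(9)] [cite: LiebPRL1989, proof of Theorem 1] [cite: DLS1978, Lemma 4.1] -/
theorem hubbard_attractive_sectorPartitionFn_sq_le (t U μ β : ℝ) (hU : U < 0) (hβ : 0 < β)
    (k l : ℕ) :
    ((spinSectorProj k l * gibbsWeight β (hamiltonianWith G t U μ)).trace).re ^ 2 ≤
      ((spinSectorProj k k * gibbsWeight β (hamiltonianWith G t U μ)).trace).re *
        ((spinSectorProj l l * gibbsWeight β (hamiltonianWith G t U μ)).trace).re := by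
  have hH := isHermitian_hamiltonianWith G t U μ
  -- sector partition functions are nonnegative
  have hnn : ∀ i j : ℕ,
      0 ≤ ((spinSectorProj i j * gibbsWeight β (hamiltonianWith G t U μ)).trace).re := fun i j =>
    Literature.LinearAlgebra.Matrix.re_trace_mul_nonneg_of_posSemidef (posSemidef_spinSectorProj i j)
      (posDef_gibbsWeight β hH).posSemidef
  have h := hubbard_attractive_sectorGaussianDomination G t U μ β hU hβ (fun _ => 0) k l
  have h0 : hamiltonianWith G t U μ - spinDensityField (fun _ : Λ => (0 : ℝ)) +
      (((∑ x : Λ, (0 : ℝ) ^ 2) / (2 * |U|) : ℝ) : ℂ) • (1 : Matrix (Finset (Orb Λ)) (Finset (Orb Λ)) ℂ) =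
      hamiltonianWith G t U μ := by
    simp [spinDensityField]
  rw [h0] at h
  have hk := hnn k k
  have hl := hnn l l
  have hkl := hnn k l
  calc ((spinSectorProj k l * gibbsWeight β (hamiltonianWith G t U μ)).trace).re ^ 2
      ≤ (Real.sqrt ((spinSectorProj k k * gibbsWeight β (hamiltonianWith G t U μ)).trace).re *
          Real.sqrt ((spinSectorProj l l * gibbsWeight β (hamiltonianWith G t U μ)).trace).re) ^ 2 :=
        pow_le_pow_left₀ hkl h 2
    _ = ((spinSectorProj k k * gibbsWeight β (hamiltonianWith G t U μ)).trace).re *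
          ((spinSectorProj l l * gibbsWeight β (hamiltonianWith G t U μ)).trace).re := by
        rw [mul_pow, Real.sq_sqrt hk, Real.sq_sqrt hl]

end Canonical

end Literature.MathematicalPhysics.QuantumLattice

end
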